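import Literature.Barriers.CriticalPhenomena.LaceExpansionIsingDeconvolutionThm22Symbols
import Literature.Barriers.CriticalPhenomena.LaceExpansionSliceRecipCalculus
import HarnessLib

/-!
# Liu–Slade 2026, Proposition 3.2 (towards `LiuSlade2026_thm22_holds`), II: the admissible
# regularised data, the massive symbols and the blocks of (3.10)

Barrier catalogue `Literature/Barriers/CriticalPhenomena/` (D-0021), proofs companion of the
named fact `LiuSlade2026_thm22` (Liu–Slade 2026, Theorem 2.2), continuing
`LaceExpansionIsingDeconvolutionThm22Symbols.lean`. The classical-derivative route to
Proposition 3.2 (see the cube reduction `LiuSlade2026_thm22_of_prop32_cube`) works with data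
`(z, β₀, β₁, Π_z)` under Assumption 2.1 in which `Π_z` is FINITELY SUPPORTED (the truncation
`piTrunc`), with a MASS `m² ∈ (0,1]` shifting the two denominators, and asks for `L^q` bounds
uniform in all such data. This file fixes that index set and the objects over it:

* `LSData d ρ βs K L₀` — a structure packaging one admissible datum: `L ≥ L₀`,
  `z, β₀, β₁, Π` with `β₀ ∨ β₁ ≤ βs` under Assumption 2.1 (`LSAssumptionF`), a finite support
  `S` of `Π`, a mass `m² ∈ (0,1]`, together with the consequences of `β` small that the printed
  argument uses as standing facts: `λ_z ∈ (0,2]`, `μ_z ∈ [0,1]` ((2.5)–(2.6),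
  `exists_lsLambda_estimates`) and the infrared bound (2.3) on the cube with constant `K`
  (`LiuSlade2026_infraredBound_holds`); the final assembly constructs such data from these facts;
* over `i : LSData …` and an axis `l`: `i.F = F_z`, `i.lam = λ_z`, `i.mu = μ_z`, `i.A = A_{μ_z}`
  (x-space), `i.E = E_{z,λ_z,μ_z} = A_{μ_z} - λ_zF_z` ((3.3)); the symbol families
  `i.symA l j = ∂_l^j Â`, `i.symF l j = ∂_l^j F̂`, `i.symE l j = ∂_l^j Ê` (`symbD`), the massive
  denominators `i.Am = Â + λm²`, `i.Fm = F̂ + m²`, the regularised `f̂`,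
  `i.fHat l = Ê/((Â + λm²)(F̂ + m²)) = 1/(F̂ + m²) - λ/(Â + λm²)` (`fHat_eq_sub`), the blocks
  `i.Ablk l γ = Â_γ/(Â+λm²)`, `i.Fblk l γ = F̂_γ/(F̂+m²)`, `i.Eblk l γ = Ê_γ/((Â+λm²)(F̂+m²))` of
  (3.10) and the reciprocal factors `i.gA`, `i.gF` (`recipFactor`);
* elementary API: finite supports, `ℤ^d`-symmetry, the chain/continuity/periodicity of the symbol
  families (from `hasDerivAt_symbD_slice`), positivity of the massive denominators
  (`Â_μ = 1 - μD̂ ≥ 0`, `F̂_z ≥ F̂_z(0) ≥ 0`), the vanishing moments `Σ E = Σ|x|²E = 0` of (3.4)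
  (`tsum_E`, `tsum_sq_mul_E`), and **the Leibniz–reciprocal expansion of `∂_l^n f̂`**
  (`sliceIterDeriv_fHat_eq_sum`, an instance of `sliceIterDeriv_quotient_eq_sum`).

No named facts.

## References

* Y. Liu, G. Slade, *Gaussian deconvolution and the lace expansion for spread-out models*,
  Ann. Inst. H. Poincaré Probab. Statist. 62 (2026), arXiv:2310.07640: Assumption 2.1, (2.3)–(2.6),
  §3.1 ((3.2)–(3.5), (3.10)), proof of Proposition 3.2 [LiuSlade2026].
-/

noncomputable section

namespace Literature.Barriers.CriticalPhenomena.SpreadOutIsing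

open _root_.MeasureTheory Filter _root_.Topology Finset Literature.Probability.LatticeModels
open scoped BigOperators Real

variable {d : ℕ}

/-! ## Part 1. Admissible regularised data -/

/-- **One admissible regularised datum for Proposition 3.2**: a level `L ≥ L₀`, parameters
`z, β₀, β₁` and a FINITELY supported `Π` under Assumption 2.1 with `β₀ ∨ β₁ ≤ β⋆`, a mass
`m² ∈ (0,1]`, and the standing consequences `λ_z ∈ (0,2]`, `μ_z ∈ [0,1]` ((2.5)–(2.6)) and the
quantitative forms `z ≤ 1 + K_λβ`, `|Σ Π| ≤ K_λβ`, `|Σ|x|²Π| ≤ K_λβ₁`, `|λ_z - 1| ≤ 2K_λβ`,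
`1 - μ_z ≤ 2K_λβ` (constant `Kl`), and the infrared bound (2.3) on the cube (constant `K`, sup norm
`‖k‖`), which the assembly derives from `exists_lsLambda_estimates` and
`LiuSlade2026_infraredBound_holds`. Uniformity of constants "in
`z, β₀, β₁, L`" (Thm. 2.2, Prop. 3.2, Lemma 3.3) is uniformity over this type.
[cite: LiuSlade2026, Assumption 2.1, (2.3), (2.5)–(2.6), Proposition 3.2 (constants independent of z, β₀, β₁, L)] -/
structure LSData (d : ℕ) (ρ βs K Kl : ℝ) (L₀ : ℕ) where
  /-- the spread-out level -/
  L : ℕ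
  /-- the parameter `z ≥ 1` -/
  z : ℝ
  /-- the small parameters `β₀, β₁ ≥ 0` of (2.2) -/
  β₀ : ℝ
  β₁ : ℝ
  /-- the coefficient function `Π_z` -/
  P : Site d → ℝ
  /-- a finite support of `Π_z` -/
  S : Finset (Site d)
  /-- the mass `m² > 0` -/
  mass : ℝ
  hL : L₀ ≤ L
  hβ₀ : 0 ≤ β₀
  hβ₁ : 0 ≤ β₁
  hβ : max β₀ β₁ ≤ βs
  hA : LSAssumptionF d L ρ β₀ β₁ z P
  hS : ∀ x ∉ S, P x = 0
  hmass : 0 < mass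
  hmass1 : mass ≤ 1
  hlam : 0 < lsLambda d L (lsF d L z P) ∧ lsLambda d L (lsF d L z P) ≤ 2
  hmu : 0 ≤ lsMu d L (lsF d L z P) ∧ lsMu d L (lsF d L z P) ≤ 1
  hz : z ≤ 1 + Kl * max β₀ β₁
  hSP : |∑' x, P x| ≤ Kl * max β₀ β₁
  hSP2 : |∑' x, euclidNorm x ^ 2 * P x| ≤ Kl * β₁
  hlam1 : |lsLambda d L (lsF d L z P) - 1| ≤ 2 * Kl * max β₀ β₁
  hmu1 : 1 - lsMu d L (lsF d L z P) ≤ 2 * Kl * max β₀ β₁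
  hIR : ∀ k ∈ cube d, K * min ((L : ℝ) ^ 2 * ‖k‖ ^ 2) 1 ≤
    (∑' x, lsF d L z P x * Real.cos (kdot k x)) - ∑' x, lsF d L z P x

namespace LSData

variable {ρ βs K Kl : ℝ} {L₀ : ℕ} (i : LSData d ρ βs K Kl L₀)

/-- `F_z = δ - zD - Π_z`. [cite: LiuSlade2026, Assumption 2.1] -/
def F : Site d → ℝ := lsF d i.L i.z i.P

/-- `λ_z` of (2.4). [cite: LiuSlade2026, (2.4)] -/
def lam : ℝ := lsLambda d i.L i.F

/-- `μ_z` of (2.4). [cite: LiuSlade2026, (2.4)] -/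
def mu : ℝ := lsMu d i.L i.F

/-- `β = β₀ ∨ β₁`. [cite: LiuSlade2026, Assumption 2.1] -/
def β : ℝ := max i.β₀ i.β₁

/-- `A_{μ_z} = δ - μ_zD` (x-space). [cite: LiuSlade2026, §3.1 (A_μ = δ - μD)] -/
def A : Site d → ℝ := soA d i.L i.mu

/-- `E_{z,λ_z,μ_z} = A_{μ_z} - λ_z F_z` of (3.3). [cite: LiuSlade2026, (3.3)] -/
def E : Site d → ℝ := fun x => i.A x - i.lam * i.F x

/-- A common finite support of `δ`, `D`, `Π_z`, hence of `F_z`, `A_μ`, `E`. [folklore] -/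
def supp : Finset (Site d) := i.S ∪ (spreadOutGraph d i.L).neighborFinset 0 ∪ {0}

variable (l : Fin d)

/-- `∂_l^j Â_{μ_z}` (`j = 0`: `Â_{μ_z} = 1 - μ_zD̂`). [cite: LiuSlade2026, (3.10) (Â_δ)] -/
def symA (j : ℕ) : (Fin d → ℝ) → ℝ := symbD i.A l j

/-- `∂_l^j F̂_z`. [cite: LiuSlade2026, (3.10) (F̂_γ)] -/
def symF (j : ℕ) : (Fin d → ℝ) → ℝ := symbD i.F l j

/-- `∂_l^j Ê`. [cite: LiuSlade2026, (3.10) (Ê_{α₂})] -/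
def symE (j : ℕ) : (Fin d → ℝ) → ℝ := symbD i.E l j

/-- The massive denominator `Â_{μ_z} + λ_z m²`. [cite: LiuSlade2026, (3.5) (the denominator Â_{μ_z} of f̂_z, here regularised)] -/
def Am (k : Fin d → ℝ) : ℝ := i.symA l 0 k + i.lam * i.mass

/-- The massive denominator `F̂_z + m²`. [cite: LiuSlade2026, (3.5) (the denominator F̂_z of f̂_z, here regularised)] -/
def Fm (k : Fin d → ℝ) : ℝ := i.symF l 0 k + i.mass

/-- The regularised `f̂_z = Ê/((Â + λm²)(F̂ + m²))` (`= 1/(F̂ + m²) - λ/(Â + λm²)`, `fHat_eq_sub`; at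
`m² = 0` this is (3.5)). [cite: LiuSlade2026, (3.5)] -/
def fHat (k : Fin d → ℝ) : ℝ := i.symE l 0 k / (i.Am l k * i.Fm l k)

/-- The block `Â_γ/(Â + λm²)`. [cite: LiuSlade2026, (3.10)] -/
def Ablk (γ : ℕ) (k : Fin d → ℝ) : ℝ := i.symA l γ k / i.Am l k

/-- The block `F̂_γ/(F̂ + m²)`. [cite: LiuSlade2026, (3.10)] -/
def Fblk (γ : ℕ) (k : Fin d → ℝ) : ℝ := i.symF l γ k / i.Fm l k

/-- The block `Ê_γ/((Â + λm²)(F̂ + m²))`. [cite: LiuSlade2026, (3.10)] -/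
def Eblk (γ : ℕ) (k : Fin d → ℝ) : ℝ := i.symE l γ k / (i.Am l k * i.Fm l k)

/-- The reciprocal factors `(Â + λm²) ∂_l^j (Â + λm²)⁻¹` (polynomials in the `Ablk`). [cite: LiuSlade2026, (3.10) (Π_n Â_{δ_n}/Â)] -/
def gA (j : ℕ) : (Fin d → ℝ) → ℝ := recipFactor l (i.symA l) (i.lam * i.mass) j

/-- The reciprocal factors `(F̂ + m²) ∂_l^j (F̂ + m²)⁻¹` (polynomials in the `Fblk`). [cite: LiuSlade2026, (3.10) (Π_m F̂_{γ_m}/F̂)] -/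
def gF (j : ℕ) : (Fin d → ℝ) → ℝ := recipFactor l (i.symF l) i.mass j

/-! ## Part 2. Elementary API -/

/-- `L ≥ 1` once `L₀ ≥ 1`. [folklore] -/
theorem one_le_L (hL₀ : 1 ≤ L₀) : 1 ≤ i.L := hL₀.trans i.hL

/-- `z ≥ 1`. [cite: LiuSlade2026, Assumption 2.1] -/
theorem one_le_z : 1 ≤ i.z := i.hA.1

/-- `Π_z` is `ℤ^d`-symmetric. [cite: LiuSlade2026, Assumption 2.1] -/
theorem isZdSymmetric_P : IsZdSymmetric i.P := i.hA.2.1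

/-- The decay bound (2.2). [cite: LiuSlade2026, (2.2)] -/
theorem abs_P_le (x : Site d) : |i.P x| ≤ i.β₀ * delta0 x + i.β₁ / jnorm x ^ ((d : ℝ) + 2 + ρ) := i.hA.2.2.1 x

/-- `0 < λ_z ≤ 2`. [cite: LiuSlade2026, (2.6)] -/
theorem lam_pos : 0 < i.lam := i.hlam.1

/-- `lam_le_two` (elementary API of the admissible data). [folklore] -/
theorem lam_le_two : i.lam ≤ 2 := i.hlam.2

/-- `0 ≤ μ_z ≤ 1`. [cite: LiuSlade2026, (2.6) ("μ_z ∈ [1 - O(β), 1]")] -/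
theorem mu_nonneg : 0 ≤ i.mu := i.hmu.1

/-- `mu_le_one` (elementary API of the admissible data). [folklore] -/
theorem mu_le_one : i.mu ≤ 1 := i.hmu.2

/-- `0 ≤ β₀ ≤ β`, `0 ≤ β₁ ≤ β ≤ βs`. [folklore] -/
theorem β_nonneg : 0 ≤ i.β := i.hβ₀.trans (le_max_left _ _)

/-- `β₀_le_β` (elementary API of the admissible data). [folklore] -/
theorem β₀_le_β : i.β₀ ≤ i.β := le_max_left _ _

/-- `β₁_le_β` (elementary API of the admissible data). [folklore] -/
theorem β₁_le_β : i.β₁ ≤ i.β := le_max_right _ _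

/-- `β_le` (elementary API of the admissible data). [folklore] -/
theorem β_le : i.β ≤ βs := i.hβ

/-! ### Finite supports -/

/-- `Π` vanishes off the finite set `i.supp ⊇ S`. [folklore] -/
theorem P_eq_zero {x : Site d} (hx : x ∉ i.supp) : i.P x = 0 :=
  i.hS x fun h => hx (by simp [supp, h])

/-- `soStep_eq_zero` (elementary API of the admissible data). [folklore] -/
theorem soStep_eq_zero {x : Site d} (hx : x ∉ i.supp) : soStep d i.L x = 0 :=
  soStep_of_not_adj fun h => hx (by
    simp only [supp, Finset.mem_union, SimpleGraph.mem_neighborFinset, Finset.mem_singleton]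
    exact Or.inl (Or.inr h))

/-- `delta0_eq_zero` (elementary API of the admissible data). [folklore] -/
theorem delta0_eq_zero {x : Site d} (hx : x ∉ i.supp) : delta0 x = 0 :=
  delta0_of_ne_zero fun h => hx (by simp [supp, h])

/-- `F_z` vanishes off `supp`. [folklore] -/
theorem F_eq_zero {x : Site d} (hx : x ∉ i.supp) : i.F x = 0 := by
  simp [F, lsF, i.P_eq_zero hx, i.soStep_eq_zero hx, i.delta0_eq_zero hx]

/-- `A_μ` vanishes off `supp`. [folklore] -/
theorem A_eq_zero {x : Site d} (hx : x ∉ i.supp) : i.A x = 0 := by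
  simp [A, soA, i.soStep_eq_zero hx, i.delta0_eq_zero hx]

/-- `E` vanishes off `supp`. [folklore] -/
theorem E_eq_zero {x : Site d} (hx : x ∉ i.supp) : i.E x = 0 := by
  simp [E, i.A_eq_zero hx, i.F_eq_zero hx]

/-! ### Symmetry and summability -/

/-- `F_z = δ - zD - Π_z` is `ℤ^d`-symmetric (as `D` and `Π_z` are). [cite: LiuSlade2026, Assumption 2.1 (symmetry of Π_z) and (1.1)] -/
theorem isZdSymmetric_F : IsZdSymmetric i.F := by
  intro σ ε x
  simp only [F, lsF, i.isZdSymmetric_P σ ε x, isZdSymmetric_soStep σ ε x]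
  unfold delta0
  simp only [signedPerm_eq_zero_iff]

/-- `isZdSymmetric_A` (elementary API of the admissible data). [folklore] -/
theorem isZdSymmetric_A : IsZdSymmetric i.A := by
  intro σ ε x
  simp only [A, soA, isZdSymmetric_soStep σ ε x]
  unfold delta0
  simp only [signedPerm_eq_zero_iff]

/-- `isZdSymmetric_E` (elementary API of the admissible data). [folklore] -/
theorem isZdSymmetric_E : IsZdSymmetric i.E := fun σ ε x => by
  simp only [E, i.isZdSymmetric_A σ ε x, i.isZdSymmetric_F σ ε x]

/-- `summable_abs_F` (elementary API of the admissible data). [folklore] -/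
theorem summable_abs_F : Summable fun x => |i.F x| :=
  summable_of_ne_finset_zero (s := i.supp) fun x hx => by rw [i.F_eq_zero hx, abs_zero]

/-- `summable_abs_P` (elementary API of the admissible data). [folklore] -/
theorem summable_abs_P : Summable fun x => |i.P x| :=
  summable_of_ne_finset_zero (s := i.supp) fun x hx => by rw [i.P_eq_zero hx, abs_zero]

/-! ### The symbol families: chain, continuity, periodicity, order zero -/

/-- `hasDerivAt_symA`: the chain `∂_l(∂_l^j Â) = ∂_l^{j+1} Â` along the slice (elementary API of the admissible data). [folklore] -/
theorem hasDerivAt_symA (j : ℕ) (k : Fin d → ℝ) :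
    HasDerivAt (sliceFun l (i.symA l j) k) (i.symA l (j + 1) k) (k l) :=
  hasDerivAt_symbD_slice (fun _ hx => i.A_eq_zero hx) l j k

/-- `hasDerivAt_symF` (elementary API of the admissible data). [folklore] -/
theorem hasDerivAt_symF (j : ℕ) (k : Fin d → ℝ) :
    HasDerivAt (sliceFun l (i.symF l j) k) (i.symF l (j + 1) k) (k l) :=
  hasDerivAt_symbD_slice (fun _ hx => i.F_eq_zero hx) l j k

/-- `hasDerivAt_symE` (elementary API of the admissible data). [folklore] -/
theorem hasDerivAt_symE (j : ℕ) (k : Fin d → ℝ) :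
    HasDerivAt (sliceFun l (i.symE l j) k) (i.symE l (j + 1) k) (k l) :=
  hasDerivAt_symbD_slice (fun _ hx => i.E_eq_zero hx) l j k

/-- `continuous_symA` (elementary API of the admissible data). [folklore] -/
theorem continuous_symA (j : ℕ) : Continuous (i.symA l j) := continuous_symbD (fun _ hx => i.A_eq_zero hx) l j

/-- `continuous_symF` (elementary API of the admissible data). [folklore] -/
theorem continuous_symF (j : ℕ) : Continuous (i.symF l j) := continuous_symbD (fun _ hx => i.F_eq_zero hx) l j

/-- `continuous_symE` (elementary API of the admissible data). [folklore] -/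
theorem continuous_symE (j : ℕ) : Continuous (i.symE l j) := continuous_symbD (fun _ hx => i.E_eq_zero hx) l j

/-- `symA_periodic` (elementary API of the admissible data). [folklore] -/
theorem symA_periodic (j : ℕ) (k : Fin d → ℝ) (s : ℝ) :
    i.symA l j (Function.update k l (s + 2 * π)) = i.symA l j (Function.update k l s) :=
  symbD_update_add_two_pi (fun _ hx => i.A_eq_zero hx) l j k s

/-- `symF_periodic` (elementary API of the admissible data). [folklore] -/
theorem symF_periodic (j : ℕ) (k : Fin d → ℝ) (s : ℝ) :
    i.symF l j (Function.update k l (s + 2 * π)) = i.symF l j (Function.update k l s) :=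
  symbD_update_add_two_pi (fun _ hx => i.F_eq_zero hx) l j k s

/-- `symE_periodic` (elementary API of the admissible data). [folklore] -/
theorem symE_periodic (j : ℕ) (k : Fin d → ℝ) (s : ℝ) :
    i.symE l j (Function.update k l (s + 2 * π)) = i.symE l j (Function.update k l s) :=
  symbD_update_add_two_pi (fun _ hx => i.E_eq_zero hx) l j k s

/-- `Ê_j = Â_j - λ F̂_j` on the symbol side (linearity). [cite: LiuSlade2026, (3.5) (Ê = Â_μ - λF̂)] -/
theorem symE_eq (j : ℕ) (k : Fin d → ℝ) : i.symE l j k = i.symA l j k - i.lam * i.symF l j k := by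
  have h := symbD_add_smul (P := i.A) (Q := i.F) (S := i.supp) (fun x hx => i.A_eq_zero hx)
    (fun x hx => i.F_eq_zero hx) 1 (-i.lam) l j k
  have hfun : i.E = fun x => 1 * i.A x + (-i.lam) * i.F x := funext fun x => by simp only [E]; ring
  simp only [symE, symA, symF, hfun, h]
  ring

/-- `Â_μ = 1 - μ D̂` at order zero, `∂_l^j Â_μ = -μ ∂_l^j D̂` (`soSymbolD`) for `j ≥ 1`. [cite: LiuSlade2026, Lemma 3.6 (Â_μ = 1 - μD̂)] -/
theorem symA_eq (j : ℕ) (k : Fin d → ℝ) :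
    i.symA l j k = (if j = 0 then 1 else 0) - i.mu * soSymbolD d i.L l j k := by
  have h := symbD_add_smul (P := (delta0 : Site d → ℝ)) (Q := soStep d i.L) (S := i.supp)
    (fun x hx => i.delta0_eq_zero hx) (fun x hx => i.soStep_eq_zero hx) 1 (-i.mu) l j k
  have hfun : i.A = fun x => 1 * delta0 x + (-i.mu) * soStep d i.L x := funext fun x => by
    simp only [A, soA]; ring
  simp only [symA, hfun, h, symbD_delta0, symbD_soStep]
  ring

/-- `F̂_z = 1 - zD̂ - Π̂` at order zero, `∂_l^j F̂_z = -z∂_l^jD̂ - ∂_l^jΠ̂` for `j ≥ 1`. [cite: LiuSlade2026, (3.17)] -/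
theorem symF_eq (j : ℕ) (k : Fin d → ℝ) :
    i.symF l j k = (if j = 0 then 1 else 0) - i.z * soSymbolD d i.L l j k - symbD i.P l j k := by
  have h1 := symbD_add_smul (P := fun x => 1 * delta0 x + (-i.z) * soStep d i.L x) (Q := i.P) (S := i.supp)
    (fun x hx => by simp [i.delta0_eq_zero hx, i.soStep_eq_zero hx]) (fun x hx => i.P_eq_zero hx) 1 (-1) l j k
  have h2 := symbD_add_smul (P := (delta0 : Site d → ℝ)) (Q := soStep d i.L) (S := i.supp)
    (fun x hx => i.delta0_eq_zero hx) (fun x hx => i.soStep_eq_zero hx) 1 (-i.z) l j k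
  have hfun : i.F = fun x => 1 * (1 * delta0 x + (-i.z) * soStep d i.L x) + (-1) * i.P x := funext fun x => by
    simp only [F, lsF]; ring
  simp only [symF, hfun, h1, h2, symbD_delta0, symbD_soStep]
  ring

/-- **`Â_{μ_z} ≥ 0`**: `1 - μD̂ ≥ 0` for `μ ∈ [0,1]`, `|D̂| ≤ 1`. [cite: LiuSlade2026, Lemma 3.6 (3.15) (Â_μ - Â_μ(0) ≥ 0)] -/
theorem symA_zero_nonneg (k : Fin d → ℝ) : 0 ≤ i.symA l 0 k := by
  rw [symA_eq, if_pos rfl, soSymbolD_zero]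
  have hD := abs_soSymbol_le_one (d := d) (L := i.L) k
  have h1 := (abs_le.1 hD).2
  nlinarith [i.mu_nonneg, i.mu_le_one]

/-- The order-zero symbol of `F_z` is the cosine series of the structure's infrared field. [folklore] -/
theorem symF_zero_eq_tsum (k : Fin d → ℝ) : i.symF l 0 k = ∑' x, i.F x * Real.cos (kdot k x) := symbD_zero _ l k

/-- `F̂_z(0) = Σ_x F_z(x) ≥ 0`. [cite: LiuSlade2026, Assumption 2.1 (F̂_z(0) ≥ 0)] -/
theorem symF_zero_at_zero : i.symF l 0 0 = ∑' x, i.F x := by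
  rw [symF_zero_eq_tsum]
  exact tsum_congr fun x => by simp [kdot]

/-- `symF_zero_at_zero_nonneg` (elementary API of the admissible data). [folklore] -/
theorem symF_zero_at_zero_nonneg : 0 ≤ i.symF l 0 0 := by
  rw [symF_zero_at_zero]; exact i.hA.2.2.2

/-- **The infrared bound (2.3) on the cube for the symbol**: `K (L²‖k‖² ∧ 1) ≤ F̂_z(k) - F̂_z(0)`,
`k ∈ [-π,π]^d`. [cite: LiuSlade2026, (2.3)] -/
theorem infrared_symF {k : Fin d → ℝ} (hk : k ∈ cube d) :
    K * min ((i.L : ℝ) ^ 2 * ‖k‖ ^ 2) 1 ≤ i.symF l 0 k - i.symF l 0 0 := by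
  rw [symF_zero_eq_tsum, symF_zero_at_zero]
  exact i.hIR k hk

/-- **`F̂_z ≥ 0` on the cube** (for `K ≥ 0`). [cite: LiuSlade2026, (2.3) with F̂_z(0) ≥ 0] -/
theorem symF_zero_nonneg (hK : 0 ≤ K) {k : Fin d → ℝ} (hk : k ∈ cube d) : 0 ≤ i.symF l 0 k := by
  have h := i.infrared_symF l hk
  have h0 := i.symF_zero_at_zero_nonneg l
  have : 0 ≤ K * min ((i.L : ℝ) ^ 2 * ‖k‖ ^ 2) 1 := mul_nonneg hK (le_min (by positivity) zero_le_one)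
  linarith

/-- **The massive denominators are positive**: `Â + λm² ≥ λm² > 0` everywhere. [folklore] -/
theorem Am_pos (k : Fin d → ℝ) : 0 < i.Am l k := by
  have := i.symA_zero_nonneg l k
  have := mul_pos i.lam_pos i.hmass
  unfold Am; linarith

/-- `lam_mul_mass_le_Am` (elementary API of the admissible data). [folklore] -/
theorem lam_mul_mass_le_Am (k : Fin d → ℝ) : i.lam * i.mass ≤ i.Am l k := by
  have := i.symA_zero_nonneg l k; unfold Am; linarith

/-- **`F̂_z` is `2π ℤ^d`-periodic**: `F̂_z(k + 2πn) = F̂_z(k)` for `n ∈ ℤ^d`. [folklore] -/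
theorem symF_zero_add_int (k : Fin d → ℝ) (n : Fin d → ℤ) :
    i.symF l 0 (fun j => k j + n j * (2 * π)) = i.symF l 0 k := by
  rw [symF, symbD_eq_sum (fun x hx => i.F_eq_zero hx), symbD_eq_sum (fun x hx => i.F_eq_zero hx)]
  refine Finset.sum_congr rfl fun x _ => ?_
  simp only [pow_zero, Nat.cast_zero, zero_mul, add_zero, one_mul]
  congr 1
  have h : kdot (fun j => k j + n j * (2 * π)) x = kdot k x + ((∑ j, n j * x j : ℤ) : ℝ) * (2 * π) := by
    unfold kdot
    push_cast
    rw [Finset.sum_mul, ← Finset.sum_add_distrib]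
    exact Finset.sum_congr rfl fun j _ => by ring
  rw [h, Real.cos_add_int_mul_two_pi]

/-- Every `k ∈ ℝ^d` is `k' + 2πn` with `k' ∈ [-π,π]^d`, `n ∈ ℤ^d`. [folklore] -/
theorem exists_cube_add_int (k : Fin d → ℝ) :
    ∃ k' ∈ cube d, ∃ n : Fin d → ℤ, k = fun j => k' j + n j * (2 * π) := by
  refine ⟨fun j => k j - round (k j / (2 * π)) * (2 * π), fun j _ => ?_, fun j => round (k j / (2 * π)),
    funext fun j => by ring⟩
  have hπ : 0 < 2 * π := Real.two_pi_pos
  have h := abs_sub_round (k j / (2 * π))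
  have h2 : |k j - round (k j / (2 * π)) * (2 * π)| ≤ π := by
    have : k j - round (k j / (2 * π)) * (2 * π) = (k j / (2 * π) - round (k j / (2 * π))) * (2 * π) := by
      field_simp
    rw [this, abs_mul, abs_of_pos hπ]
    nlinarith
  exact ⟨by linarith [(abs_le.1 h2).1], by linarith [(abs_le.1 h2).2]⟩

/-- **`F̂_z ≥ 0` everywhere** (`K ≥ 0`; by periodicity from the cube). [cite: LiuSlade2026, (2.3) with F̂_z(0) ≥ 0] -/
theorem symF_zero_nonneg_everywhere (hK : 0 ≤ K) (k : Fin d → ℝ) : 0 ≤ i.symF l 0 k := by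
  obtain ⟨k', hk', n, rfl⟩ := exists_cube_add_int k
  rw [i.symF_zero_add_int l k' n]
  exact i.symF_zero_nonneg l hK hk'

/-- **The massive denominator `F̂ + m² ≥ m² > 0` everywhere** (`K ≥ 0`). [folklore] -/
theorem Fm_pos (hK : 0 ≤ K) (k : Fin d → ℝ) : 0 < i.Fm l k := by
  have := i.symF_zero_nonneg_everywhere l hK k
  unfold Fm; linarith [i.hmass]

/-- `mass_le_Fm` (elementary API of the admissible data). [folklore] -/
theorem mass_le_Fm (hK : 0 ≤ K) (k : Fin d → ℝ) : i.mass ≤ i.Fm l k := by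
  have := i.symF_zero_nonneg_everywhere l hK k; unfold Fm; linarith

/-! ### `f̂ = 1/(F̂ + m²) - λ/(Â + λm²)` and its derivatives -/

/-- **The regularised `f̂` is `1/(F̂ + m²) - λ/(Â + λm²)`** (`Ê = Â - λF̂`; the choice of the shifts
`λm²`, `m²` keeps the numerator equal to `Ê`). [cite: LiuSlade2026, (3.5)] -/
theorem fHat_eq_sub (hK : 0 ≤ K) (k : Fin d → ℝ) : i.fHat l k = 1 / i.Fm l k - i.lam / i.Am l k := by
  have hA := (i.Am_pos l k).ne'
  have hF := (i.Fm_pos l hK k).ne'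
  rw [fHat, i.symE_eq l 0 k]
  have hE : i.symA l 0 k - i.lam * i.symF l 0 k = i.Am l k - i.lam * i.Fm l k := by
    simp only [Am, Fm]; ring
  rw [hE, div_sub_div _ _ hF hA]
  congr 1 <;> ring

/-- The slices of `f̂` are smooth. [folklore] -/
theorem contDiff_sliceFun_fHat (hK : 0 ≤ K) (k : Fin d → ℝ) (n : ℕ) : ContDiff ℝ n (sliceFun l (i.fHat l) k) := by
  have hu : sliceFun l (i.fHat l) k = fun s => sliceFun l (i.symE l 0) k s *
      ((sliceFun l (i.Am l) k s)⁻¹ * (sliceFun l (i.Fm l) k s)⁻¹) := by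
    funext s
    simp only [sliceFun_apply, fHat, div_eq_mul_inv, mul_inv]
  rw [hu]
  refine (contDiff_sliceFun_of_chain (i.hasDerivAt_symE l) n 0 k).mul (ContDiff.mul ?_ ?_)
  · exact (contDiff_sliceFun_add_const (i.hasDerivAt_symA l) n _ k).inv fun s => (i.Am_pos l _).ne'
  · exact (contDiff_sliceFun_add_const (i.hasDerivAt_symF l) n _ k).inv fun s => (i.Fm_pos l hK _).ne'

/-- **The Leibniz–reciprocal expansion of `∂_l^n f̂`** (instance of `sliceIterDeriv_quotient_eq_sum`):
`∂_l^n f̂ = Σ_{a ≤ n} Σ_{j ≤ n-a} C(n,a)C(n-a,j) Ê_a (g^A_j/(Â+λm²)) (g^F_{n-a-j}/(F̂+m²))`.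
[cite: LiuSlade2026, (3.10) and the proof of Proposition 3.2] -/
theorem sliceIterDeriv_fHat_eq_sum (hK : 0 ≤ K) (n : ℕ) (k : Fin d → ℝ) :
    sliceIterDeriv l n (i.fHat l) k =
      ∑ a ∈ range (n + 1), ∑ j ∈ range (n - a + 1), (n.choose a : ℝ) * ((n - a).choose j : ℝ) *
        i.symE l a k * (i.gA l j k / i.Am l k) * (i.gF l (n - a - j) k / i.Fm l k) :=
  sliceIterDeriv_quotient_eq_sum (i.hasDerivAt_symA l) (i.hasDerivAt_symF l) (i.hasDerivAt_symE l)
    (fun k => (i.Am_pos l k).ne') (fun k => (i.Fm_pos l hK k).ne') n k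

/-- Continuity of `∂_l^n f̂` on `ℝ^d`. [folklore] -/
theorem continuous_sliceIterDeriv_fHat (hK : 0 ≤ K) (n : ℕ) : Continuous (sliceIterDeriv l n (i.fHat l)) :=
  continuous_sliceIterDeriv_quotient (i.hasDerivAt_symA l) (i.hasDerivAt_symF l) (i.hasDerivAt_symE l)
    (fun k => (i.Am_pos l k).ne') (fun k => (i.Fm_pos l hK k).ne') (i.continuous_symA l)
    (i.continuous_symF l) (i.continuous_symE l) n

/-- The chain property `(d/ds)(∂_l^m f̂)(k[l↦s])|_{s=k_l} = ∂_l^{m+1} f̂ (k)`. [folklore] -/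
theorem hasDerivAt_sliceIterDeriv_fHat (hK : 0 ≤ K) (m : ℕ) (k : Fin d → ℝ) :
    HasDerivAt (sliceFun l (sliceIterDeriv l m (i.fHat l)) k) (sliceIterDeriv l (m + 1) (i.fHat l) k) (k l) :=
  hasDerivAt_sliceFun_sliceIterDeriv (fun k n => i.contDiff_sliceFun_fHat l hK k n) m k

/-- `f̂` is `2π`-periodic in `k_l`, hence so are its slice derivatives across the faces of the cube.
[folklore] -/
theorem fHat_periodic (k : Fin d → ℝ) (s : ℝ) :
    i.fHat l (Function.update k l (s + 2 * π)) = i.fHat l (Function.update k l s) := by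
  simp only [fHat, Am, Fm, i.symE_periodic, i.symA_periodic, i.symF_periodic]

/-- `sliceIterDeriv_fHat_update_neg_pi` (elementary API of the admissible data). [folklore] -/
theorem sliceIterDeriv_fHat_update_neg_pi (m : ℕ) (k : Fin d → ℝ) :
    sliceIterDeriv l m (i.fHat l) (Function.update k l (-π)) = sliceIterDeriv l m (i.fHat l) (Function.update k l π) :=
  sliceIterDeriv_update_neg_pi (i.fHat_periodic l) m k

end LSData

end Literature.Barriers.CriticalPhenomena.SpreadOutIsing

end
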